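import Literature.Analysis.Pluripotential.LaplacianSubMeanValue
import Literature.Analysis.Complex.DiscSubMeanValue
import Mathlib.MeasureTheory.Measure.Lebesgue.VolumeOfBalls
import Mathlib.Analysis.InnerProductSpace.Calculus
import HarnessLib

/-!
# The mean value inequality for `Δw ≥ -A w²` (the "Heinz trick")

Topic `Literature/Analysis/PDE` (planar elliptic estimates), the analytic engine of the mean
value inequality for `J`-holomorphic curves and of the bubbling analysis in Gromov compactness
(McDuff–Salamon (2012), §4.3: Lemma 4.3.2 is the statement below, Lemma 4.3.1 applies it to the
energy density `w = |du|²` of a `J`-holomorphic curve, which satisfies `Δw ≥ -A w²`). For a `C²`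
function `w ≥ 0` on a neighbourhood of the closed disc `D̄(z₀, r) ⊆ ℂ` with

  `Δw ≥ -A w²` on `D̄(z₀, r)`  and  `16 A ∫_{D(z₀, r)} w < π`,

one has **`w(z₀) ≤ (8 / (π r²)) ∫_{D(z₀, r)} w`** (`heinz_trick`). The Laplacian is written, as
in `Literature/Analysis/Pluripotential/LaplacianSubMeanValue.lean`, in the flat form
`D²w(z)(1,1) + D²w(z)(i,i)` with Mathlib's `fderiv ℝ (fderiv ℝ w)`.

* `pi_mul_sq_mul_ofReal_le_lintegral_ball_of_laplacian_nonneg` — the **sub-mean-value inequality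
  over discs**, `π R² u(c) ≤ ∫∫_{D(c,R)} u` for `u ≥ 0` of class `C²` near `D̄(c, R)` with
  `Δu ≥ 0` (the tree's circle inequality
  `Literature.Analysis.Pluripotential.le_circleAverage_of_laplacian_nonneg_of_contDiffOn`,
  Hörmander Thm. 1.6.3, integrated in polar coordinates; `ℝ≥0∞`-valued);
* `fderiv_fderiv_norm_sub_sq_apply`, `laplacianFlat_norm_sub_sq`,
  `fderiv_fderiv_add_const_mul_norm_sub_sq` — `D²|z - a|² = 2⟨·,·⟩`, `Δ|z - a|² = 4`, and the
  second derivative of `w + C|z - a|²`;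
* `heinz_trick` — the theorem (Heinz (1955) for `H`-surfaces; Schoen (1984) for harmonic maps;
  McDuff–Salamon, Lemma 4.3.2; our smallness threshold `16 A ∫ w < π` is cruder than the book's
  `8 A ∫ w < π` because `∫_{D_ρ} |z - z_*|²` is bounded by `π ρ⁴` rather than computed as `π ρ⁴/2`;
  the conclusion `w(z₀) ≤ (8/π r²) ∫ w` is the book's).

Everything is proved; no definitions, no named facts.

## References

* D. McDuff, D. Salamon, *J-holomorphic Curves and Symplectic Topology*, 2nd ed., AMS
  Colloquium Publ. 52 (2012), §4.3, Lemma 4.3.1, Lemma 4.3.2. [McDuffSalamon2012]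
* L. Hörmander, *An Introduction to Complex Analysis in Several Variables* (1973), Thm. 1.6.3.
  [HormanderSCV1973]
-/

noncomputable section

open scoped Topology ENNReal Real RealInnerProductSpace
open MeasureTheory Filter Set Metric Complex

namespace Literature.Analysis.PDE

open Literature.Analysis.Pluripotential (le_circleAverage_of_laplacian_nonneg_of_contDiffOn)
open Literature.Analysis.Complex (lintegral_Ioo_ofReal_self)

/-! ### The sub-mean-value inequality over discs for `C²` functions with `Δu ≥ 0` -/

/-- **Sub-mean-value inequality over discs** (`C²` case of Hörmander (1973), Thm. 1.6.3 /
Ransford (1995), Thm. 2.4.4, solid form): if `u` is `C²` on an open `U ⊇ D̄(c, R)`, `R > 0`, with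
`D²u(z)(1,1) + D²u(z)(i,i) ≥ 0` and `u ≥ 0` on `D̄(c, R)`, then
`π R² u(c) ≤ ∫∫_{D(c,R)} u` (the circle inequality
`Literature.Analysis.Pluripotential.le_circleAverage_of_laplacian_nonneg_of_contDiffOn` integrated
in polar coordinates `ρ dρ dθ`; stated with Lebesgue integrals of the non-negative function, so
that no integrability bookkeeping is needed). [cite: HormanderSCV1973, Thm. 1.6.3] -/
theorem pi_mul_sq_mul_ofReal_le_lintegral_ball_of_laplacian_nonneg {u : ℂ → ℝ} {U : Set ℂ}
    (hU : IsOpen U) (hu : ContDiffOn ℝ 2 u U) {c : ℂ} {R : ℝ} (hR : 0 < R)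
    (hcR : closedBall c R ⊆ U)
    (hΔ : ∀ z ∈ closedBall c R, 0 ≤ fderiv ℝ (fderiv ℝ u) z 1 1 + fderiv ℝ (fderiv ℝ u) z I I)
    (h0 : ∀ z ∈ closedBall c R, 0 ≤ u z) :
    ENNReal.ofReal (π * R ^ 2) * ENNReal.ofReal (u c) ≤
      ∫⁻ z in ball c R, ENNReal.ofReal (u z) := by
  classical
  set G : ℂ → ℝ≥0∞ := (ball c R).indicator fun z ↦ ENNReal.ofReal (u z) with hG
  have huc : ContinuousOn u (closedBall c R) := hu.continuousOn.mono hcR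
  have hGm : Measurable G := by
    have hcont : ContinuousOn (fun z ↦ ENNReal.ofReal (u z)) (ball c R) :=
      ENNReal.continuous_ofReal.comp_continuousOn (huc.mono ball_subset_closedBall)
    rw [hG, ← Set.piecewise_eq_indicator]
    exact hcont.measurable_piecewise continuousOn_const measurableSet_ball
  -- polar coordinates about `c`
  have hpolar : ∫⁻ z in ball c R, ENNReal.ofReal (u z) = ∫⁻ ρ in Ioi (0 : ℝ), ∫⁻ θ in Ioo (-π) π,
      ENNReal.ofReal ρ * G (circleMap c ρ θ) := by
    rw [← lintegral_indicator measurableSet_ball, ← lintegral_add_left_eq_self _ c,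
      ← Complex.lintegral_comp_polarCoord_symm]
    simp only [Literature.Analysis.Complex.LengthArea.polarCoord_symm_eq, smul_eq_mul]
    rw [Literature.Analysis.Complex.LengthArea.lintegral_polarCoord_target_eq]
    · rfl
    · exact measurable_fst.ennreal_ofReal.mul (hGm.comp (by fun_prop))
  -- the circle inequality, as a Lebesgue integral over `(-π, π)`
  have hcircle : ∀ ρ ∈ Ioo (0 : ℝ) R, ENNReal.ofReal (2 * π) * ENNReal.ofReal (u c) ≤
      ∫⁻ θ in Ioo (-π) π, G (circleMap c ρ θ) := by
    intro ρ hρ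
    have hmem : ∀ θ, circleMap c ρ θ ∈ ball c R := fun θ ↦ by
      rw [mem_ball, mem_sphere.1 (circleMap_mem_sphere c hρ.1.le θ)]
      exact hρ.2
    have hmv : u c ≤ Real.circleAverage u c ρ :=
      le_circleAverage_of_laplacian_nonneg_of_contDiffOn hU hu hcR hΔ hρ.1 hρ.2.le
    rw [Real.circleAverage_eq_integral_add (-π),
      intervalIntegral.integral_comp_add_right (fun θ ↦ u (circleMap c ρ θ)), zero_add,
      show 2 * π + -π = π by ring, smul_eq_mul] at hmv
    have hπ : -π ≤ π := by linarith [Real.pi_pos]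
    have hcont : Continuous fun θ ↦ u (circleMap c ρ θ) :=
      huc.comp_continuous (continuous_circleMap c ρ) fun θ ↦ ball_subset_closedBall (hmem θ)
    have hnn : ∀ θ, 0 ≤ u (circleMap c ρ θ) := fun θ ↦ h0 _ (ball_subset_closedBall (hmem θ))
    have hint : IntegrableOn (fun θ ↦ u (circleMap c ρ θ)) (Ioc (-π) π) :=
      (hcont.integrableOn_Icc (a := -π) (b := π)).mono_set Ioc_subset_Icc_self
    have h1 : 2 * π * u c ≤ ∫ θ in Ioc (-π) π, u (circleMap c ρ θ) := by
      rw [← intervalIntegral.integral_of_le hπ]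
      have h2π : (0 : ℝ) < 2 * π := by positivity
      calc 2 * π * u c ≤ 2 * π * ((2 * π)⁻¹ * ∫ θ in (-π)..π, u (circleMap c ρ θ)) :=
            mul_le_mul_of_nonneg_left hmv h2π.le
        _ = ∫ θ in (-π)..π, u (circleMap c ρ θ) := by
            rw [← mul_assoc, mul_inv_cancel₀ h2π.ne', one_mul]
    calc ENNReal.ofReal (2 * π) * ENNReal.ofReal (u c)
        = ENNReal.ofReal (2 * π * u c) := (ENNReal.ofReal_mul (by positivity)).symm
      _ ≤ ENNReal.ofReal (∫ θ in Ioc (-π) π, u (circleMap c ρ θ)) := ENNReal.ofReal_le_ofReal h1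
      _ = ∫⁻ θ in Ioc (-π) π, ENNReal.ofReal (u (circleMap c ρ θ)) :=
          ofReal_integral_eq_lintegral_ofReal hint (ae_of_all _ hnn)
      _ = ∫⁻ θ in Ioo (-π) π, G (circleMap c ρ θ) := by
          rw [← restrict_Ioo_eq_restrict_Ioc]
          refine lintegral_congr fun θ ↦ ?_
          rw [hG, indicator_of_mem (hmem θ)]
  -- integrate `ρ dρ` over `(0, R)`
  have hc : ENNReal.ofReal (2 * π) * ENNReal.ofReal (u c) ≠ ∞ :=
    ENNReal.mul_ne_top ENNReal.ofReal_ne_top ENNReal.ofReal_ne_top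
  rw [hpolar]
  calc ENNReal.ofReal (π * R ^ 2) * ENNReal.ofReal (u c)
      = ∫⁻ ρ in Ioo (0 : ℝ) R, ENNReal.ofReal ρ * (ENNReal.ofReal (2 * π) * ENNReal.ofReal (u c)) := by
        rw [lintegral_mul_const' _ _ hc, lintegral_Ioo_ofReal_self hR.le, ← mul_assoc]
        congr 1
        rw [← ENNReal.ofReal_mul (by positivity)]
        congr 1
        ring
    _ ≤ ∫⁻ ρ in Ioo (0 : ℝ) R, ENNReal.ofReal ρ * ∫⁻ θ in Ioo (-π) π, G (circleMap c ρ θ) := by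
        refine setLIntegral_mono' measurableSet_Ioo fun ρ hρ ↦ ?_
        gcongr
        exact hcircle ρ hρ
    _ = ∫⁻ ρ in Ioo (0 : ℝ) R, ∫⁻ θ in Ioo (-π) π, ENNReal.ofReal ρ * G (circleMap c ρ θ) := by
        refine setLIntegral_congr_fun measurableSet_Ioo fun ρ _ ↦ ?_
        rw [← lintegral_const_mul' _ _ ENNReal.ofReal_ne_top]
    _ ≤ ∫⁻ ρ in Ioi (0 : ℝ), ∫⁻ θ in Ioo (-π) π, ENNReal.ofReal ρ * G (circleMap c ρ θ) :=
        lintegral_mono_set Ioo_subset_Ioi_self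

/-! ### The flat Laplacian of `‖z - a‖²` and of a sum -/

/-- `D²(‖· - a‖²)(z)(h, k) = 2⟪h, k⟫`. [folklore] -/
theorem fderiv_fderiv_norm_sub_sq_apply (a z h k : ℂ) :
    fderiv ℝ (fderiv ℝ fun w : ℂ ↦ ‖w - a‖ ^ 2) z h k = 2 * ⟪h, k⟫ := by
  have hd1 : ∀ w : ℂ, HasFDerivAt (fun w : ℂ ↦ ‖w - a‖ ^ 2)
      (2 • (innerSL ℝ (w - a)).comp (ContinuousLinearMap.id ℝ ℂ)) w :=
    fun w ↦ (hasFDerivAt_sub_const a).norm_sq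
  have hfd : fderiv ℝ (fun w : ℂ ↦ ‖w - a‖ ^ 2) =
      fun w ↦ (2 • (innerSL ℝ : ℂ →L[ℝ] ℂ →L[ℝ] ℝ)) (w - a) := by
    funext w
    rw [(hd1 w).fderiv, ContinuousLinearMap.comp_id]
    rfl
  have hd2 : HasFDerivAt (fun w : ℂ ↦ (2 • (innerSL ℝ : ℂ →L[ℝ] ℂ →L[ℝ] ℝ)) (w - a))
      ((2 • (innerSL ℝ : ℂ →L[ℝ] ℂ →L[ℝ] ℝ)).comp (ContinuousLinearMap.id ℝ ℂ)) z :=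
    (2 • (innerSL ℝ : ℂ →L[ℝ] ℂ →L[ℝ] ℝ)).hasFDerivAt.comp z (hasFDerivAt_sub_const a)
  rw [hfd, hd2.fderiv]
  simp only [ContinuousLinearMap.comp_apply, ContinuousLinearMap.id_apply,
    FunLike.coe_smul, Pi.smul_apply, innerSL_apply_apply]
  rw [two_nsmul, two_mul]

/-- The flat Laplacian of `‖· - a‖²` on `ℂ` is `4`. [folklore] -/
theorem laplacianFlat_norm_sub_sq (a z : ℂ) :
    fderiv ℝ (fderiv ℝ fun w : ℂ ↦ ‖w - a‖ ^ 2) z 1 1 +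
      fderiv ℝ (fderiv ℝ fun w : ℂ ↦ ‖w - a‖ ^ 2) z I I = 4 := by
  rw [fderiv_fderiv_norm_sub_sq_apply, fderiv_fderiv_norm_sub_sq_apply,
    real_inner_self_eq_norm_sq, real_inner_self_eq_norm_sq]
  simp
  norm_num

/-- Second derivative of `w + C ‖· - a‖²` at a point where `w` is `C²`. [folklore] -/
theorem fderiv_fderiv_add_const_mul_norm_sub_sq {w : ℂ → ℝ} {U : Set ℂ} (hU : IsOpen U)
    (hw : ContDiffOn ℝ 2 w U) (C : ℝ) (a : ℂ) {z : ℂ} (hz : z ∈ U) (h k : ℂ) :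
    fderiv ℝ (fderiv ℝ fun y : ℂ ↦ w y + C * ‖y - a‖ ^ 2) z h k =
      fderiv ℝ (fderiv ℝ w) z h k + C * (2 * ⟪h, k⟫) := by
  set q : ℂ → ℝ := fun y ↦ ‖y - a‖ ^ 2 with hq
  have hqC : ContDiff ℝ 2 q := (contDiff_norm_sq ℝ).comp (contDiff_id.sub contDiff_const)
  have hw2 : ∀ y ∈ U, ContDiffAt ℝ 2 w y := fun y hy ↦ hw.contDiffAt (hU.mem_nhds hy)
  -- first derivatives near `z`
  have h1 : fderiv ℝ (fun y : ℂ ↦ w y + C * q y) =ᶠ[𝓝 z] fun y ↦ fderiv ℝ w y + C • fderiv ℝ q y := by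
    filter_upwards [hU.mem_nhds hz] with y hy
    have hwd : DifferentiableAt ℝ w y := (hw2 y hy).differentiableAt (by simp)
    have hqd : DifferentiableAt ℝ q y := hqC.differentiable (by simp) y
    rw [fderiv_fun_add hwd (hqd.const_mul C), fderiv_const_mul hqd]
  rw [h1.fderiv_eq]
  have hwd2 : DifferentiableAt ℝ (fderiv ℝ w) z :=
    ((hw2 z hz).fderiv_right (m := 1) (by norm_num)).differentiableAt one_ne_zero
  have hqd2 : DifferentiableAt ℝ (fderiv ℝ q) z :=
    (hqC.contDiffAt.fderiv_right (m := 1) (by norm_num)).differentiableAt one_ne_zero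
  have hqd2' : DifferentiableAt ℝ (fun y ↦ C • fderiv ℝ q y) z := hqd2.const_smul C
  rw [fderiv_fun_add hwd2 hqd2', fderiv_fun_const_smul hqd2]
  simp only [_root_.add_apply, FunLike.coe_smul, Pi.smul_apply, smul_eq_mul]
  rw [hq, fderiv_fderiv_norm_sub_sq_apply]

/-! ### The Heinz trick -/

/-- **The mean value inequality for `Δw ≥ -A w²` (the "Heinz trick").** Let `w` be `C²` on an
open `U ⊇ D̄(z₀, r)`, `r > 0`, `A ≥ 0`, with `w ≥ 0` and
`Δw := D²w(z)(1,1) + D²w(z)(i,i) ≥ -A w²` on `D̄(z₀, r)`. If `16 A ∫_{D(z₀,r)} w < π` then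

  `w(z₀) ≤ (8 / (π r²)) ∫_{D(z₀,r)} w`.

This is McDuff–Salamon (2012), Lemma 4.3.2 (there with the sharper smallness threshold
`∫ w < π/(8A)`; the proof below bounds `∫_{D_ρ} |z - z_*|²` by `π ρ⁴` instead of `π ρ⁴/2`), the
analytic engine of the mean value inequality for `J`-holomorphic curves (ibid. Lemma 4.3.1) and
of every bubbling argument. Proof (Heinz, Schoen): maximise `φ(z) = (r - |z - z₀|)² w(z)` over
the closed disc, at `z_*` with `c = w(z_*)`, `ε = (r - |z_* - z₀|)/2`; then `w ≤ 4c` on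
`D̄(z_*, ε)`, so `v = w + 4Ac²|z - z_*|²` has `Δv ≥ 0` there and the sub-mean-value inequality
(`pi_mul_sq_mul_ofReal_le_lintegral_ball_of_laplacian_nonneg`) gives
`c ≤ (π ρ²)⁻¹ ∫_{D(z₀,r)} w + 4Ac²ρ²` for `ρ ≤ ε`; the choice `ρ = ε` (if `8Acε² ≤ 1`) yields the
claim through `r² w(z₀) = φ(z₀) ≤ φ(z_*) = 4ε²c`, and `ρ² = 1/(8Ac)` (otherwise) contradicts the
smallness of `∫ w`. [cite: McDuffSalamon2012, Lemma 4.3.2] -/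
theorem heinz_trick {w : ℂ → ℝ} {U : Set ℂ} (hU : IsOpen U) (hw : ContDiffOn ℝ 2 w U)
    {z₀ : ℂ} {r A : ℝ} (hr : 0 < r) (hA : 0 ≤ A) (hsub : closedBall z₀ r ⊆ U)
    (hw0 : ∀ z ∈ closedBall z₀ r, 0 ≤ w z)
    (hΔ : ∀ z ∈ closedBall z₀ r,
      -(A * w z ^ 2) ≤ fderiv ℝ (fderiv ℝ w) z 1 1 + fderiv ℝ (fderiv ℝ w) z I I)
    (hE : 16 * A * ∫ z in ball z₀ r, w z < π) :
    w z₀ ≤ 8 / (π * r ^ 2) * ∫ z in ball z₀ r, w z := by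
  set E := ∫ z in ball z₀ r, w z with hEdef
  have hwc : ContinuousOn w (closedBall z₀ r) := hw.continuousOn.mono hsub
  have hE0 : 0 ≤ E :=
    setIntegral_nonneg measurableSet_ball fun z hz ↦ hw0 z (ball_subset_closedBall hz)
  have hwi : IntegrableOn w (ball z₀ r) :=
    (hwc.integrableOn_compact (isCompact_closedBall _ _)).mono_set ball_subset_closedBall
  have hEl : ∫⁻ z in ball z₀ r, ENNReal.ofReal (w z) = ENNReal.ofReal E := by
    rw [hEdef, ofReal_integral_eq_lintegral_ofReal hwi (ae_restrict_of_forall_mem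
      measurableSet_ball fun z hz ↦ hw0 z (ball_subset_closedBall hz))]
  -- maximise `φ z = (r - |z - z₀|)² w z` over the closed disc
  set φ : ℂ → ℝ := fun z ↦ (r - dist z z₀) ^ 2 * w z with hφ
  have hφc : ContinuousOn φ (closedBall z₀ r) :=
    ((continuous_const.sub (continuous_id.dist continuous_const)).pow 2).continuousOn.mul hwc
  obtain ⟨zs, hzs, hmax⟩ := (isCompact_closedBall z₀ r).exists_isMaxOn
    (nonempty_closedBall.2 hr.le) hφc
  have hmax' : ∀ z ∈ closedBall z₀ r, (r - dist z z₀) ^ 2 * w z ≤ (r - dist zs z₀) ^ 2 * w zs :=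
    fun z hz ↦ isMaxOn_iff.1 hmax z hz
  have hρs : dist zs z₀ ≤ r := mem_closedBall.1 hzs
  have hc0 : 0 ≤ w zs := hw0 zs hzs
  have hcentre : r ^ 2 * w z₀ ≤ (r - dist zs z₀) ^ 2 * w zs := by
    have h := hmax' z₀ (mem_closedBall_self hr.le)
    rwa [dist_self, sub_zero] at h
  -- it suffices to bound the maximum of `φ`
  suffices hmain : (r - dist zs z₀) ^ 2 * w zs ≤ 8 * E / π by
    have hπr : 0 < π * r ^ 2 := by positivity
    rw [div_mul_eq_mul_div, le_div_iff₀ hπr]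
    have h1 : r ^ 2 * w z₀ ≤ 8 * E / π := hcentre.trans hmain
    rw [le_div_iff₀ Real.pi_pos] at h1
    linarith
  by_cases hdeg : (r - dist zs z₀) ^ 2 * w zs = 0
  · rw [hdeg]
    positivity
  have hc : 0 < w zs := by
    rcases hc0.lt_or_eq with h | h
    · exact h
    · exact absurd (by rw [← h, mul_zero]) hdeg
  have hρr : dist zs z₀ < r := by
    rcases hρs.lt_or_eq with h | h
    · exact h
    · exact absurd (by rw [h, sub_self]; ring) hdeg
  set c := w zs with hcdef
  set ε := (r - dist zs z₀) / 2 with hεdef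
  have hε : 0 < ε := by rw [hεdef]; linarith
  have h4ε : (r - dist zs z₀) ^ 2 = 4 * ε ^ 2 := by rw [hεdef]; ring
  -- `D̄(z_*, ε) ⊆ D(z₀, r)`
  have hball : closedBall zs ε ⊆ ball z₀ r := fun z hz ↦ by
    rw [mem_ball]
    rw [mem_closedBall] at hz
    calc dist z z₀ ≤ dist z zs + dist zs z₀ := dist_triangle _ _ _
      _ ≤ ε + dist zs z₀ := by gcongr
      _ < r := by rw [hεdef]; linarith
  have hballr : closedBall zs ε ⊆ closedBall z₀ r := hball.trans ball_subset_closedBall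
  have hballU : closedBall zs ε ⊆ U := hballr.trans hsub
  -- `w ≤ 4c` on `D̄(z_*, ε)`
  have h4c : ∀ z ∈ closedBall zs ε, w z ≤ 4 * c := by
    intro z hz
    have hzr : z ∈ closedBall z₀ r := hballr hz
    have hφz := hmax' z hzr
    have hdz : ε ≤ r - dist z z₀ := by
      rw [mem_closedBall] at hz
      have := dist_triangle z zs z₀
      rw [hεdef] at hz ⊢
      linarith
    have hε2 : ε ^ 2 * w z ≤ (r - dist z z₀) ^ 2 * w z :=
      mul_le_mul_of_nonneg_right (pow_le_pow_left₀ hε.le hdz 2) (hw0 z hzr)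
    rw [h4ε] at hφz
    have hε2pos : 0 < ε ^ 2 := by positivity
    nlinarith
  -- the comparison function `v = w + C |z - z_*|²`, `C = 4 A c²`
  set C := 4 * A * c ^ 2 with hCdef
  have hC0 : 0 ≤ C := by positivity
  have hvC : ContDiffOn ℝ 2 (fun y : ℂ ↦ w y + C * ‖y - zs‖ ^ 2) U :=
    hw.add (contDiff_const.mul ((contDiff_norm_sq ℝ).comp
      (contDiff_id.sub contDiff_const))).contDiffOn
  have hv0 : ∀ y ∈ closedBall zs ε, 0 ≤ w y + C * ‖y - zs‖ ^ 2 := fun y hy ↦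
    add_nonneg (hw0 y (hballr hy)) (by positivity)
  have hΔv : ∀ y ∈ closedBall zs ε,
      0 ≤ fderiv ℝ (fderiv ℝ fun y : ℂ ↦ w y + C * ‖y - zs‖ ^ 2) y 1 1 +
        fderiv ℝ (fderiv ℝ fun y : ℂ ↦ w y + C * ‖y - zs‖ ^ 2) y I I := by
    intro y hy
    have hyU : y ∈ U := hballU hy
    rw [fderiv_fderiv_add_const_mul_norm_sub_sq hU hw C zs hyU,
      fderiv_fderiv_add_const_mul_norm_sub_sq hU hw C zs hyU, real_inner_self_eq_norm_sq,
      real_inner_self_eq_norm_sq, norm_one, Complex.norm_I]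
    have hyr := hballr hy
    have h1 := hΔ y hyr
    have h2 : w y ^ 2 ≤ (4 * c) ^ 2 := pow_le_pow_left₀ (hw0 y hyr) (h4c y hy) 2
    have h3 : A * w y ^ 2 ≤ A * (4 * c) ^ 2 := mul_le_mul_of_nonneg_left h2 hA
    rw [hCdef]
    nlinarith
  -- the sub-mean-value inequality for `v` on `D(z_*, ρ)`, `ρ ≤ ε`, in real form
  have hmvi : ∀ ρ, 0 < ρ → ρ ≤ ε → π * ρ ^ 2 * c ≤ E + C * ρ ^ 2 * (π * ρ ^ 2) := by
    intro ρ hρ hρε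
    have hsubρ : closedBall zs ρ ⊆ closedBall zs ε := closedBall_subset_closedBall hρε
    have key := pi_mul_sq_mul_ofReal_le_lintegral_ball_of_laplacian_nonneg hU hvC hρ
      (hsubρ.trans hballU) (fun y hy ↦ hΔv y (hsubρ hy)) (fun y hy ↦ hv0 y (hsubρ hy))
    rw [sub_self, norm_zero, zero_pow two_ne_zero, mul_zero, add_zero] at key
    have hbr : ball zs ρ ⊆ ball z₀ r := (ball_subset_closedBall.trans hsubρ).trans hball
    have hwm : AEMeasurable (fun y ↦ ENNReal.ofReal (w y)) (volume.restrict (ball zs ρ)) :=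
      (ENNReal.continuous_ofReal.comp_continuousOn
        (hwc.mono (hbr.trans ball_subset_closedBall))).aemeasurable measurableSet_ball
    have hvol : volume (ball zs ρ) = ENNReal.ofReal (π * ρ ^ 2) := by
      rw [Complex.volume_ball, ENNReal.ofReal_mul Real.pi_pos.le, ← NNReal.coe_real_pi,
        ENNReal.ofReal_coe_nnreal, ENNReal.ofReal_pow hρ.le, mul_comm]
    have hsplit : ∫⁻ y in ball zs ρ, ENNReal.ofReal (w y + C * ‖y - zs‖ ^ 2) ≤
        ENNReal.ofReal E + ENNReal.ofReal (C * ρ ^ 2) * ENNReal.ofReal (π * ρ ^ 2) := by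
      calc ∫⁻ y in ball zs ρ, ENNReal.ofReal (w y + C * ‖y - zs‖ ^ 2)
          = ∫⁻ y in ball zs ρ, (ENNReal.ofReal (w y) + ENNReal.ofReal (C * ‖y - zs‖ ^ 2)) := by
            refine setLIntegral_congr_fun measurableSet_ball fun y hy ↦ ?_
            exact ENNReal.ofReal_add (hw0 y (ball_subset_closedBall (hbr hy))) (by positivity)
        _ = (∫⁻ y in ball zs ρ, ENNReal.ofReal (w y)) +
              ∫⁻ y in ball zs ρ, ENNReal.ofReal (C * ‖y - zs‖ ^ 2) := lintegral_add_left' hwm _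
        _ ≤ (∫⁻ y in ball z₀ r, ENNReal.ofReal (w y)) +
              ∫⁻ _ in ball zs ρ, ENNReal.ofReal (C * ρ ^ 2) := by
            gcongr ?_ + ?_
            · exact lintegral_mono_set hbr
            · refine setLIntegral_mono measurable_const fun y hy ↦ ?_
              refine ENNReal.ofReal_le_ofReal (mul_le_mul_of_nonneg_left ?_ hC0)
              rw [mem_ball, dist_eq_norm] at hy
              exact pow_le_pow_left₀ (norm_nonneg _) hy.le 2
        _ = ENNReal.ofReal E + ENNReal.ofReal (C * ρ ^ 2) * ENNReal.ofReal (π * ρ ^ 2) := by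
            rw [hEl, setLIntegral_const, hvol]
    have hfin := key.trans hsplit
    rw [← ENNReal.ofReal_mul (by positivity), ← ENNReal.ofReal_mul (by positivity),
      ← ENNReal.ofReal_add hE0 (by positivity), ENNReal.ofReal_le_ofReal_iff (by positivity)]
      at hfin
    linarith
  -- case analysis on `8 A c ε²`
  rw [h4ε]
  by_cases hcase : 8 * A * c * ε ^ 2 ≤ 1
  · -- `ρ = ε`
    have h := hmvi ε hε le_rfl
    have hquad : C * ε ^ 2 * (π * ε ^ 2) ≤ c / 2 * (π * ε ^ 2) := by
      refine mul_le_mul_of_nonneg_right ?_ (by positivity)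
      rw [hCdef]
      nlinarith
    rw [le_div_iff₀ Real.pi_pos]
    nlinarith
  · -- `ρ² = 1/(8Ac) < ε²`: contradiction with the smallness of `∫ w`
    push Not at hcase
    have hA0 : 0 < A := by
      rcases hA.lt_or_eq with h | h
      · exact h
      · rw [← h] at hcase
        norm_num at hcase
    set ρ := Real.sqrt (1 / (8 * A * c)) with hρdef
    have hρ2 : ρ ^ 2 = 1 / (8 * A * c) := Real.sq_sqrt (by positivity)
    have hρpos : 0 < ρ := Real.sqrt_pos.2 (by positivity)
    have hρε : ρ ≤ ε := by
      have hlt : ρ ^ 2 < ε ^ 2 := by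
        rw [hρ2, div_lt_iff₀ (by positivity)]
        nlinarith
      exact (lt_of_pow_lt_pow_left₀ 2 hε.le hlt).le
    have h := hmvi ρ hρpos hρε
    have h1 : π * ρ ^ 2 * c = π / (8 * A) := by
      rw [hρ2]
      field_simp
    have h2 : C * ρ ^ 2 * (π * ρ ^ 2) = π / (16 * A) := by
      rw [hCdef, hρ2]
      field_simp
      ring
    rw [h1, h2] at h
    have h3 : π / (8 * A) = π / (16 * A) + π / (16 * A) := by
      field_simp
      ring
    have h4 : π / (16 * A) ≤ E := by linarith
    rw [div_le_iff₀ (by positivity)] at h4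
    linarith

end Literature.Analysis.PDE

end
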